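import Mathlib.AlgebraicGeometry.IdealSheaf.Basic
import Mathlib.AlgebraicGeometry.AffineScheme
import Literature.AlgebraicGeometry.Resolution.WeightedResolutionDatum
import HarnessLib

/-!
# The ideal sheaf contracted from a primary germ at a point — centres along an orbit closure, read at its
# generic point

Route `ResolutionOfSingularities/WeightedInvariant`, door crux `HypersurfaceCentreConstruction`
(stmt-ResolutionOfSingularities-19897) — OURS, helper; e-ladder plan of `res-L1-w43-stub-10`, stub
`stub_e1_centre` / T-e1-L0 (cell res-hironaka, `D/res-D-pv-025/DOOR-ELADDER-PLAN.md` §6, skeleton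
`E1Skeleton.lean`): the centre of rung `e = 1` along a closed singular orbit `𝒬 = closure {η}` is the
CONTRACTION of the Abramovich–Quek–Schober centre germ at the generic point `η` (a filtration of
`𝔪_η`-primary ideals of the regular 2-dimensional local ring `𝒪_{Y,η}`).  This file builds that contraction
for any scheme, point and germ ideal — no descent, no torus:

* `germContractionIdeal η I U` — on an affine open `U`: the preimage of `I ⊆ 𝒪_{Y,η}` under
  `Γ(Y, U) → 𝒪_{Y,η}` if `η ∈ U`, the unit ideal otherwise;
* `germContraction η I hI : Y.IdealSheafData` — these ideals ARE an ideal sheaf as soon as `I` contains a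
  power of the maximal ideal (`hI : ∃ N, 𝔪_η ^ N ≤ I`): compatibility with basic opens is
  `IsLocalization.map_comap` on `Γ(Y, D(f)) = Γ(Y, U)[1/f]` when `η ∈ D(f)`, and «`f` is not a unit at `η` ⇒
  `f^N ∈` the contraction ⇒ unit ideal on `D(f)`» when `η ∈ U ∖ D(f)`;
* `germContraction_ideal_of_mem` / `_of_not_mem`, `support_germContraction` (`= closure {η}` for a proper
  `I`), `germContraction_antitone`, `germContraction_top`, `germContraction_mul_le`;
* `ReesAlgebraData.ofGermFiltration` — a decreasing multiplicative filtration `I 0 = ⊤ ⊇ I 1 ⊇ …` of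
  `𝔪_η`-primary germ ideals gives a Rees algebra on `Y` supported on `closure {η}` (the shape
  `IsAdmissibleCentre` / `HypersurfaceTerminatingCentreDatum` consume).

Pure scheme plumbing on Mathlib's `Scheme.IdealSheafData`; nothing here is a claim about Hironaka's problem.
-/

noncomputable section

set_option linter.dupNamespace false -- mandated namespace of this single-conjunct summit

namespace Summit.ResolutionOfSingularities.ResolutionOfSingularities.Theorems

universe u

open CategoryTheory AlgebraicGeometry TopologicalSpace IsLocalRing Opposite
open Literature.AlgebraicGeometry.Resolution

variable {Y : Scheme.{u}} (η : Y)

/-! ## The contracted ideals on affine opens -/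

open scoped Classical in
/-- The ideal CONTRACTED from the germ ideal `I ⊆ 𝒪_{Y,η}` on the affine open `U`: the preimage of `I`
under the germ map `Γ(Y, U) → 𝒪_{Y,η}` if `η ∈ U`, and the unit ideal if `η ∉ U`. [folklore] -/
def germContractionIdeal (I : Ideal (Y.presheaf.stalk η)) (U : Y.affineOpens) : Ideal Γ(Y, U) :=
  if h : η ∈ (U : Y.Opens) then I.comap (Y.presheaf.germ (U : Y.Opens) η h).hom else ⊤

/-- On an affine open containing `η`, the contracted ideal is the preimage of `I`. [folklore] -/
theorem germContractionIdeal_of_mem (I : Ideal (Y.presheaf.stalk η)) {U : Y.affineOpens}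
    (h : η ∈ (U : Y.Opens)) :
    germContractionIdeal η I U = I.comap (Y.presheaf.germ (U : Y.Opens) η h).hom := by
  classical
  exact dif_pos h

/-- On an affine open missing `η`, the contracted ideal is the unit ideal. [folklore] -/
theorem germContractionIdeal_of_not_mem (I : Ideal (Y.presheaf.stalk η)) {U : Y.affineOpens}
    (h : η ∉ (U : Y.Opens)) : germContractionIdeal η I U = ⊤ := by
  classical
  exact dif_neg h

/-- Membership, on an affine open containing `η`. [folklore] -/
theorem mem_germContractionIdeal_iff (I : Ideal (Y.presheaf.stalk η)) {U : Y.affineOpens}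
    (h : η ∈ (U : Y.Opens)) (s : Γ(Y, U)) :
    s ∈ germContractionIdeal η I U ↔ (Y.presheaf.germ (U : Y.Opens) η h).hom s ∈ I := by
  rw [germContractionIdeal_of_mem η I h, Ideal.mem_comap]

/-- The contraction is monotone in the germ ideal. [folklore] -/
theorem germContractionIdeal_mono {I J : Ideal (Y.presheaf.stalk η)} (hIJ : I ≤ J) (U : Y.affineOpens) :
    germContractionIdeal η I U ≤ germContractionIdeal η J U := by
  by_cases h : η ∈ (U : Y.Opens)
  · rw [germContractionIdeal_of_mem η I h, germContractionIdeal_of_mem η J h]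
    exact Ideal.comap_mono hIJ
  · rw [germContractionIdeal_of_not_mem η J h]
    exact le_top

/-- The contraction of the unit germ ideal is the unit ideal. [folklore] -/
theorem germContractionIdeal_top (U : Y.affineOpens) :
    germContractionIdeal η (⊤ : Ideal (Y.presheaf.stalk η)) U = ⊤ := by
  by_cases h : η ∈ (U : Y.Opens)
  · rw [germContractionIdeal_of_mem η ⊤ h, Ideal.comap_top]
  · exact germContractionIdeal_of_not_mem η ⊤ h

/-- The contraction is submultiplicative. [folklore] -/
theorem germContractionIdeal_mul_le (I J : Ideal (Y.presheaf.stalk η)) (U : Y.affineOpens) :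
    germContractionIdeal η I U * germContractionIdeal η J U ≤ germContractionIdeal η (I * J) U := by
  by_cases h : η ∈ (U : Y.Opens)
  · rw [germContractionIdeal_of_mem η I h, germContractionIdeal_of_mem η J h,
      germContractionIdeal_of_mem η (I * J) h, Ideal.mul_le]
    intro a ha b hb
    rw [Ideal.mem_comap] at ha hb ⊢
    rw [map_mul]
    exact Ideal.mul_mem_mul ha hb
  · rw [germContractionIdeal_of_not_mem η (I * J) h]
    exact le_top

/-! ## Compatibility with basic opens: the contracted ideals form an ideal sheaf -/

/-- **The contracted ideals of a germ ideal containing a power of `𝔪_η` are compatible with basic opens.**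
For `η ∈ D(f) ⊆ U` this is `IsLocalization.map_comap` (`Γ(Y, D(f))` is `Γ(Y, U)[1/f]` and the germ map
factors through it); for `η ∈ U ∖ D(f)` the germ of `f` lies in `𝔪_η`, so `f^N` lies in the contraction,
whose extension to `D(f)` is then the unit ideal; for `η ∉ U` both sides are the unit ideal. [folklore] -/
theorem map_germContractionIdeal_basicOpen (I : Ideal (Y.presheaf.stalk η))
    (hI : ∃ N : ℕ, maximalIdeal (Y.presheaf.stalk η) ^ N ≤ I) (U : Y.affineOpens) (f : Γ(Y, U)) :
    (germContractionIdeal η I U).map (Y.presheaf.map (homOfLE <| Y.basicOpen_le f).op).hom =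
      germContractionIdeal η I (Y.affineBasicOpen f) := by
  by_cases hU : η ∈ (U : Y.Opens)
  · by_cases hf : η ∈ Y.basicOpen f
    · -- both contractions: localisation
      have hf' : η ∈ ((Y.affineBasicOpen f : Y.affineOpens) : Y.Opens) := hf
      rw [germContractionIdeal_of_mem η I hU, germContractionIdeal_of_mem η I hf']
      have hgerm : (Y.presheaf.germ (U : Y.Opens) η hU).hom =
          (Y.presheaf.germ (Y.basicOpen f) η hf).hom.comp
            (Y.presheaf.map (homOfLE <| Y.basicOpen_le f).op).hom := by
        rw [← CommRingCat.hom_comp, TopCat.Presheaf.germ_res]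
      rw [hgerm, ← Ideal.comap_comap]
      haveI := U.2.isLocalization_basicOpen f
      exact IsLocalization.map_under (Submonoid.powers f) (S := Γ(Y, Y.basicOpen f))
        (I.comap (Y.presheaf.germ (Y.basicOpen f) η hf).hom)
    · -- `η ∈ U ∖ D(f)`: `f` is not a unit at `η`, so a power of it is contracted, and `f` is a unit on `D(f)`
      have hf' : η ∉ ((Y.affineBasicOpen f : Y.affineOpens) : Y.Opens) := hf
      rw [germContractionIdeal_of_mem η I hU, germContractionIdeal_of_not_mem η I hf']
      obtain ⟨N, hN⟩ := hI
      have hmem : (Y.presheaf.germ (U : Y.Opens) η hU).hom f ∈ maximalIdeal (Y.presheaf.stalk η) := by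
        rw [mem_maximalIdeal, mem_nonunits_iff]
        exact fun hu => hf ((Y.mem_basicOpen f η hU).mpr hu)
      have hfN : f ^ N ∈ I.comap (Y.presheaf.germ (U : Y.Opens) η hU).hom := by
        rw [Ideal.mem_comap, map_pow]
        exact hN (Ideal.pow_mem_pow hmem N)
      have hunit : IsUnit ((Y.presheaf.map (homOfLE <| Y.basicOpen_le f).op).hom (f ^ N)) := by
        rw [map_pow]
        exact (RingedSpace.isUnit_res_basicOpen (X := Y.toRingedSpace) f).pow N
      exact Ideal.eq_top_of_isUnit_mem _ (Ideal.mem_map_of_mem _ hfN) hunit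
  · -- `η ∉ U`: both sides are the unit ideal
    have hf' : η ∉ ((Y.affineBasicOpen f : Y.affineOpens) : Y.Opens) := fun h => hU (Y.basicOpen_le f h)
    rw [germContractionIdeal_of_not_mem η I hU, germContractionIdeal_of_not_mem η I hf', Ideal.map_top]
    rfl

/-- **The ideal sheaf contracted from a germ ideal containing a power of `𝔪_η`.** [folklore] -/
def germContraction (I : Ideal (Y.presheaf.stalk η))
    (hI : ∃ N : ℕ, maximalIdeal (Y.presheaf.stalk η) ^ N ≤ I) : Y.IdealSheafData where
  ideal := germContractionIdeal η I
  map_ideal_basicOpen := map_germContractionIdeal_basicOpen η I hI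

/-- The ideals of the contracted sheaf are the contracted ideals. [folklore] -/
@[simp] theorem germContraction_ideal (I : Ideal (Y.presheaf.stalk η))
    (hI : ∃ N : ℕ, maximalIdeal (Y.presheaf.stalk η) ^ N ≤ I) (U : Y.affineOpens) :
    (germContraction η I hI).ideal U = germContractionIdeal η I U := rfl

/-- The contracted sheaf is monotone in the germ ideal. [folklore] -/
theorem germContraction_mono {I J : Ideal (Y.presheaf.stalk η)}
    (hI : ∃ N : ℕ, maximalIdeal (Y.presheaf.stalk η) ^ N ≤ I)
    (hJ : ∃ N : ℕ, maximalIdeal (Y.presheaf.stalk η) ^ N ≤ J) (hIJ : I ≤ J) :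
    germContraction η I hI ≤ germContraction η J hJ :=
  fun U => germContractionIdeal_mono η hIJ U

/-- The contraction of the unit germ ideal is the unit ideal sheaf. [folklore] -/
theorem germContraction_top (h : ∃ N : ℕ, maximalIdeal (Y.presheaf.stalk η) ^ N ≤ (⊤ : Ideal _)) :
    germContraction η ⊤ h = ⊤ :=
  Scheme.IdealSheafData.ext (funext fun U => germContractionIdeal_top η U)

/-- The contraction is submultiplicative. [folklore] -/
theorem germContraction_mul_le (I J : Ideal (Y.presheaf.stalk η))
    (hI : ∃ N : ℕ, maximalIdeal (Y.presheaf.stalk η) ^ N ≤ I)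
    (hJ : ∃ N : ℕ, maximalIdeal (Y.presheaf.stalk η) ^ N ≤ J)
    (hIJ : ∃ N : ℕ, maximalIdeal (Y.presheaf.stalk η) ^ N ≤ I * J) :
    germContraction η I hI * germContraction η J hJ ≤ germContraction η (I * J) hIJ := by
  intro U
  rw [Scheme.IdealSheafData.ideal_mul]
  exact germContractionIdeal_mul_le η I J U

/-! ## The support is the closure of the point -/

/-- **The support of the contracted sheaf of a PROPER germ ideal is the closure of `η`.**  A point outside
`closure {η}` has an affine neighbourhood missing `η`, where the sheaf is the unit ideal; at a point `y` of
`closure {η}` every section of the contracted ideal over an affine `U ∋ y` vanishes at `y` — otherwise it would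
be a unit on a basic open containing `y`, hence `η`, while its germ at `η` lies in the proper ideal `I`.
[folklore] -/
theorem support_germContraction (I : Ideal (Y.presheaf.stalk η))
    (hI : ∃ N : ℕ, maximalIdeal (Y.presheaf.stalk η) ^ N ≤ I) (hI' : I ≠ ⊤) :
    ((germContraction η I hI).support : Set Y) = closure {η} := by
  ext y
  constructor
  · intro hy
    by_contra hyc
    -- an affine neighbourhood of `y` missing `η`
    have hopen : IsOpen (closure ({η} : Set Y))ᶜ := isClosed_closure.isOpen_compl
    obtain ⟨_, ⟨U, hU, rfl⟩, hyU, hUc⟩ :=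
      Y.isBasis_affineOpens.exists_subset_of_mem_open (Set.mem_compl hyc) hopen
    have hηU : η ∉ U := fun h => hUc h (subset_closure (Set.mem_singleton η))
    have hmem := (Scheme.IdealSheafData.mem_supportSet_iff_of_mem (I := germContraction η I hI)
      (U := ⟨U, hU⟩) hyU).mp hy
    rw [germContraction_ideal, germContractionIdeal_of_not_mem η I (U := ⟨U, hU⟩) hηU,
      Scheme.mem_zeroLocus_iff] at hmem
    exact hmem 1 Submodule.mem_top ((Y.mem_basicOpen (1 : Γ(Y, U)) y hyU).mpr (by
      rw [map_one]; exact isUnit_one))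
  · intro hy
    -- an affine neighbourhood of `y`; it contains `η`
    obtain ⟨_, ⟨U, hU, rfl⟩, hyU, -⟩ :=
      Y.isBasis_affineOpens.exists_subset_of_mem_open (Set.mem_univ y) isOpen_univ
    have hηU : η ∈ U := by
      by_contra h
      exact (mem_closure_iff.mp hy U U.isOpen hyU).elim fun z ⟨hzU, hz⟩ => h (Set.mem_singleton_iff.mp hz ▸ hzU)
    refine (Scheme.IdealSheafData.mem_supportSet_iff_of_mem (I := germContraction η I hI)
      (U := ⟨U, hU⟩) hyU).mpr ?_
    rw [germContraction_ideal, Scheme.mem_zeroLocus_iff]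
    intro s hs hys
    -- `s` is a unit near `y`, hence at `η ∈ closure {y}`… rather: `η ∈ D(s)` since `D(s)` is open, contains
    -- `y`, and `y ∈ closure {η}`
    have hηs : η ∈ Y.basicOpen s := by
      obtain ⟨z, hzs, hz⟩ := mem_closure_iff.mp hy (Y.basicOpen s) (Y.basicOpen s).isOpen hys
      rwa [Set.mem_singleton_iff.mp hz] at hzs
    have hunit : IsUnit ((Y.presheaf.germ U η hηU).hom s) := (Y.mem_basicOpen s η hηU).mp hηs
    rw [SetLike.mem_coe, mem_germContractionIdeal_iff η I (U := ⟨U, hU⟩) hηU] at hs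
    exact hI' (Ideal.eq_top_of_isUnit_mem I hs hunit)

/-! ## Rees algebras from germ filtrations -/

/-- **The Rees algebra on `Y` contracted from a filtration of `𝔪_η`-primary germ ideals** (`I 0 = ⊤`,
`I m · I n ⊆ I (m + n)`, each `I n` containing a power of `𝔪_η`): pieces the contracted ideal sheaves.  The
shape by which the centre of rung `e = 1` along an orbit closure `closure {η}` is built from the
Abramovich–Quek–Schober chart germ at `η`. [folklore] -/
def _root_.Literature.AlgebraicGeometry.Resolution.ReesAlgebraData.ofGermFiltration
    (I : ℕ → Ideal (Y.presheaf.stalk η)) (h0 : I 0 = ⊤) (hmul : ∀ m n, I m * I n ≤ I (m + n))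
    (hprim : ∀ n, ∃ N : ℕ, maximalIdeal (Y.presheaf.stalk η) ^ N ≤ I n) : ReesAlgebraData Y where
  piece n := germContraction η (I n) (hprim n)
  piece_zero := by
    have h : ∃ N : ℕ, maximalIdeal (Y.presheaf.stalk η) ^ N ≤ (⊤ : Ideal _) := ⟨0, le_top⟩
    have : germContraction η (I 0) (hprim 0) = germContraction η ⊤ h := by
      congr 1
    rw [this, germContraction_top]
  piece_mul_le m n :=
    (germContraction_mul_le η (I m) (I n) (hprim m) (hprim n)
      (by obtain ⟨N, hN⟩ := hprim (m + n)
          obtain ⟨M₁, hM₁⟩ := hprim m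
          obtain ⟨M₂, hM₂⟩ := hprim n
          exact ⟨M₁ + M₂, by rw [pow_add]; exact Ideal.mul_mono hM₁ hM₂⟩)).trans
      (germContraction_mono η _ (hprim (m + n)) (hmul m n))

/-- The pieces of `ofGermFiltration` on an affine open containing `η` are the contracted ideals. [folklore] -/
theorem ofGermFiltration_piece_ideal_of_mem (I : ℕ → Ideal (Y.presheaf.stalk η)) (h0 : I 0 = ⊤)
    (hmul : ∀ m n, I m * I n ≤ I (m + n))
    (hprim : ∀ n, ∃ N : ℕ, maximalIdeal (Y.presheaf.stalk η) ^ N ≤ I n) (n : ℕ) {U : Y.affineOpens}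
    (hU : η ∈ (U : Y.Opens)) :
    ((ReesAlgebraData.ofGermFiltration η I h0 hmul hprim).piece n).ideal U =
      (I n).comap (Y.presheaf.germ (U : Y.Opens) η hU).hom :=
  germContractionIdeal_of_mem η (I n) hU

/-- **The support of `ofGermFiltration` is the closure of `η`** as soon as some positive piece is a proper
germ ideal and all positive pieces are proper. [folklore] -/
theorem support_ofGermFiltration (I : ℕ → Ideal (Y.presheaf.stalk η)) (h0 : I 0 = ⊤)
    (hmul : ∀ m n, I m * I n ≤ I (m + n))
    (hprim : ∀ n, ∃ N : ℕ, maximalIdeal (Y.presheaf.stalk η) ^ N ≤ I n)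
    (hproper : ∀ n, 0 < n → I n ≠ ⊤) :
    (ReesAlgebraData.ofGermFiltration η I h0 hmul hprim).support = closure {η} := by
  ext y
  rw [ReesAlgebraData.mem_support_iff]
  constructor
  · intro h
    have h1 := h 1 one_pos
    change y ∈ ((germContraction η (I 1) (hprim 1)).support : Set Y) at h1
    rwa [support_germContraction η (I 1) (hprim 1) (hproper 1 one_pos)] at h1
  · intro hy n hn
    change y ∈ ((germContraction η (I n) (hprim n)).support : Set Y)
    rw [support_germContraction η (I n) (hprim n) (hproper n hn)]
    exact hy

end Summit.ResolutionOfSingularities.ResolutionOfSingularities.Theorems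

end
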